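import Literature.Geometry.Lorentzian.StabilityOfMinimizers
import Literature.Geometry.Lorentzian.AmbientVectorFieldExtension
import Literature.Topology.FourManifolds.CompactSupportFlow
import HarnessLib

/-!
# Stability of area-minimising embedded minimal surfaces (Schoen–Yau 1979, (2.13)) via ambient flows

`StabilityOfMinimizers.lean` derives the stability inequality (2.13) of Schoen–Yau 1979 from the
first and second variation of area along two smooth families of immersions `F`, `G` with
prescribed variation fields. This file constructs those families as composites of a fixed
immersion with the flows of compactly supported ambient vector fields (Hirsch 1976, Ch. 8 §1,
Thm. 1.2: `uflowIsotopy`, `CompactSupportFlow.lean`), and packages the minimality hypothesis: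

* `SurfaceVariation.IsAreaMinimizingOn hpb F₀ K` — **`F₀` minimises area on the compact `K`
  among compactly supported smooth deformations through immersions**: for every smooth family
  `F : ℝ → S → X` of immersions with `F 0 = F₀` which agrees with `F₀` outside a compact subset of
  the interior of `K` at all times, `μ_{F₀^*h}(K) ≤ μ_{F_t^*h}(K)` for all `t` (what an
  area-minimising surface in the sense of geometric measure theory satisfies: each `F_t|_K` is a
  competitor with the same boundary);
* `SurfaceVariation.contMDiff_isotopy_comp`, `isSpacelikeImmersion_isotopy_comp`,
  `tvelocity_isotopy_comp`, `acceleration_isotopy_comp` — the family `t ↦ Ψ_t ∘ F₀` for an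
  ambient isotopy `Ψ` whose tracks are integral curves of a field `V`: smooth, immersions,
  variation field `V ∘ F₀`, acceleration field `(∇_V V) ∘ F₀`;
* `SurfaceVariation.stability_of_isAreaMinimizingOn` — **area-minimising embedded minimal
  surfaces are stable**: for a smooth embedding `F₀ : S → X` of a surface into a Riemannian
  `3`-manifold (Hausdorff, σ-compact, locally compact) which is a minimal immersion with smooth
  unit normal `ν`, every `f ∈ C_c^∞(S)` and every compact `K` containing `supp f` in its interior
  on which `F₀` is area-minimising:
  `∫_K (Ric(ν,ν) + ‖A‖²) f² dμ ≤ ∫_K ‖∇f‖² dμ` — Schoen–Yau, Comm. Math. Phys. 65 (1979), p. 53,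
  (2.13). The two families are the flows of a compactly supported extension `Z` of `f ν`
  (`exists_ambient_extension`) and of `∇_Z Z`.

Everything is proved; the only definition is `IsAreaMinimizingOn`; no named facts.

## References

* R. Schoen, S.-T. Yau, Comm. Math. Phys. 65 (1979) 45–76, §2, (2.13), p. 53. [SchoenYauPMT1979]
* H. B. Lawson, *Lectures on minimal submanifolds*, Vol. I (1980), Ch. I §7.
* M. W. Hirsch, *Differential Topology* (1976), Ch. 8 §1, Thms. 1.1–1.2. [HirschDT1976]
-/

noncomputable section

open Bundle Set Manifold TopologicalSpace Filter Function MeasureTheory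
open scoped ContDiff Topology Manifold Matrix ENNReal

namespace Literature.Geometry.Lorentzian

open PseudoRiemannianMetric Literature.Topology.FourManifolds

namespace SurfaceVariation

variable {X : Type*} [TopologicalSpace X] [ChartedSpace E3 X] [IsManifold (𝓡 3) ∞ X]
  {h : ContMDiffRiemannianMetric (𝓡 3) ∞ E3 (TangentSpace (𝓡 3) : X → Type _)}
  [(ofRiemannian h).HasLeviCivita]
  {S : Type*} [TopologicalSpace S] [ChartedSpace (EuclideanSpace ℝ (Fin 2)) S]
  [IsManifold (𝓡 2) ∞ S]

/-! ### Area-minimising immersions on a compact set -/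

/-- **`F₀` minimises area on the set `K` among compactly supported smooth deformations through
immersions**: for every smooth one-parameter family `F : ℝ → S → X` of immersions with `F 0 = F₀`
which, at all times, agrees with `F₀` outside some compact subset of the interior of `K`, the area of
`K` does not decrease: `μ_{F_0^*h}(K) ≤ μ_{F_t^*h}(K)` for every `t`. This is the property of the
area-minimising surfaces of Schoen–Yau 1979, §2, Step 2 (p. 49: "a complete area minimizing
surface"; Federer 1969, 5.1.6) that enters the stability inequality (2.13): each deformed piece
`F_t|_K` is a competitor with the same boundary. A DEFINITION (predicate on `(h, F₀, K)`), not a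
named fact. [cite: SchoenYauPMT1979, §2, Step 2 (p. 49) and (2.13) (p. 53)] -/
def IsAreaMinimizingOn [T3Space S] [MeasurableSpace S] [BorelSpace S]
    (hpb : contMDiff_pullbackBilin (𝓡 3) X (𝓡 2) S ∞) (F₀ : S → X) (K : Set S) : Prop :=
  ∀ (F : ℝ → S → X), ContMDiff (𝓘(ℝ, ℝ).prod (𝓡 2)) (𝓡 3) ∞ (fun q : ℝ × S ↦ F q.1 q.2) →
    ∀ (himm : ∀ t, (ofRiemannian h).IsSpacelikeImmersion (𝓡 2) (F t)), F 0 = F₀ →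
    (∃ K' : Set S, IsCompact K' ∧ K' ⊆ interior K ∧ ∀ t y, y ∉ K' → F t y = F₀ y) →
    ∀ t, riemannianMeasure ((ofRiemannian h).inducedRiemannianMetric (F 0) hpb (himm 0)) K ≤
      riemannianMeasure ((ofRiemannian h).inducedRiemannianMetric (F t) hpb (himm t)) K

/-! ### Families obtained by composing with an ambient isotopy -/

section Isotopy

variable {hpb : contMDiff_pullbackBilin (𝓡 3) X (𝓡 2) S ∞} {F₀ : S → X}
  {V : Π x : X, TangentSpace (𝓡 3) x}

omit [(ofRiemannian h).HasLeviCivita] [IsManifold (𝓡 3) ∞ X] [IsManifold (𝓡 2) ∞ S] in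
/-- The family `(t, y) ↦ Ψ_t (F₀ y)` is jointly smooth. [folklore] -/
theorem contMDiff_isotopy_comp (Ψ : AmbientIsotopy (𝓡 3) X) (hF₀ : ContMDiff (𝓡 2) (𝓡 3) ∞ F₀) :
    ContMDiff (𝓘(ℝ, ℝ).prod (𝓡 2)) (𝓡 3) ∞ (fun q : ℝ × S ↦ Ψ.toFun q.1 (F₀ q.2)) :=
  Ψ.contMDiff.comp (contMDiff_fst.prodMk (hF₀.comp contMDiff_snd))

omit [(ofRiemannian h).HasLeviCivita] [IsManifold (𝓡 2) ∞ S] in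
/-- Each stage `Ψ_t ∘ F₀` of the family is an immersion (composite of an immersion with a
diffeomorphism, whose differential is injective; the ambient metric is positive definite).
[folklore] -/
theorem isSpacelikeImmersion_isotopy_comp (Ψ : AmbientIsotopy (𝓡 3) X)
    (hF₀ : (ofRiemannian h).IsSpacelikeImmersion (𝓡 2) F₀) (t : ℝ) :
    (ofRiemannian h).IsSpacelikeImmersion (𝓡 2) (fun y ↦ Ψ.toFun t (F₀ y)) := by
  refine ⟨(((Ψ.contMDiff_toFun t).comp hF₀.contMDiff_self).of_le (by simp)), fun y v hv ↦ ?_⟩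
  have hΨd : MDifferentiableAt (𝓡 3) (𝓡 3) (Ψ.toFun t) (F₀ y) :=
    ((Ψ.contMDiff_toFun t) _).mdifferentiableAt (by simp)
  have hFd : MDifferentiableAt (𝓡 2) (𝓡 3) F₀ y := (hF₀.contMDiff_self y).mdifferentiableAt (by simp)
  have hcomp : mfderiv (𝓡 2) (𝓡 3) (fun y ↦ Ψ.toFun t (F₀ y)) y v =
      mfderiv (𝓡 3) (𝓡 3) (Ψ.toFun t) (F₀ y) (mfderiv (𝓡 2) (𝓡 3) F₀ y v) :=
    mfderiv_comp_apply (I' := 𝓡 3) y hΨd hFd v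
  rw [inducedBilin_apply, hcomp]
  have hne : mfderiv (𝓡 2) (𝓡 3) F₀ y v ≠ 0 := fun h0 ↦ hv (hF₀.injective_mfderiv y (by
    rw [h0, map_zero]))
  have hn : (∞ : ℕ∞ω) ≠ 0 := by simp
  have hinj := (((Ψ.isLocalDiffeomorph t) (F₀ y)).mfderivToContinuousLinearEquiv hn).injective
  have hne' : mfderiv (𝓡 3) (𝓡 3) (Ψ.toFun t) (F₀ y) (mfderiv (𝓡 2) (𝓡 3) F₀ y v) ≠ 0 := by
    intro h0
    apply hne
    apply hinj
    change mfderiv (𝓡 3) (𝓡 3) (Ψ.toFun t) (F₀ y) _ = mfderiv (𝓡 3) (𝓡 3) (Ψ.toFun t) (F₀ y) 0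
    rw [h0, map_zero]
  exact isRiemannian_ofRiemannian h _ _ hne'

omit [(ofRiemannian h).HasLeviCivita] [IsManifold (𝓡 3) ∞ X] [TopologicalSpace S]
  [ChartedSpace (EuclideanSpace ℝ (Fin 2)) S] [IsManifold (𝓡 2) ∞ S] in
/-- At time `0` the family is `F₀`. [folklore] -/
theorem isotopy_comp_zero (Ψ : AmbientIsotopy (𝓡 3) X) : (fun y ↦ Ψ.toFun 0 (F₀ y)) = F₀ := by
  funext y
  rw [Ψ.map_zero]
  rfl

omit [(ofRiemannian h).HasLeviCivita] [IsManifold (𝓡 3) ∞ X] [TopologicalSpace S]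
  [ChartedSpace (EuclideanSpace ℝ (Fin 2)) S] [IsManifold (𝓡 2) ∞ S] in
/-- **The variation field of `t ↦ Ψ_t ∘ F₀` is `V ∘ Ψ_t ∘ F₀`** when the tracks of `Ψ` are integral
curves of `V`. [cite: HirschDT1976, Ch. 8 §1, Thm. 1.1] -/
theorem tvelocity_isotopy_comp (Ψ : AmbientIsotopy (𝓡 3) X)
    (hΨV : ∀ x, IsMIntegralCurve (fun t ↦ Ψ.toFun t x) V) (t : ℝ) (y : S) :
    tvelocity (𝓡 3) (fun t y ↦ Ψ.toFun t (F₀ y)) t y = V (Ψ.toFun t (F₀ y)) := by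
  have h1 := (hΨV (F₀ y) t).mfderiv
  rw [tvelocity_apply, velocity]
  change mfderiv 𝓘(ℝ, ℝ) (𝓡 3) (fun s ↦ Ψ.toFun s (F₀ y)) t 1 = _
  rw [h1]
  exact one_smul ℝ (V (Ψ.toFun t (F₀ y)))

omit [TopologicalSpace S] [ChartedSpace (EuclideanSpace ℝ (Fin 2)) S] [IsManifold (𝓡 2) ∞ S] in
/-- **The acceleration field of `t ↦ Ψ_t ∘ F₀` at `0` is `(∇_V V) ∘ F₀`** (covariant derivative
along the flow line of its velocity field `V ∘ γ`: `covariantDerivAlong_comp`). O'Neill 1983,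
Ch. 3, Prop. 3.18 (3). [cite: ONeill1983, Ch. 3, Prop. 18 (3)] -/
theorem acceleration_isotopy_comp (Ψ : AmbientIsotopy (𝓡 3) X)
    (hV : ContMDiff (𝓡 3) (𝓡 3).tangent ∞ (fun x ↦ (TotalSpace.mk' E3 x (V x) : TangentBundle (𝓡 3) X)))
    (hΨV : ∀ x, IsMIntegralCurve (fun t ↦ Ψ.toFun t x) V) (y : S) :
    (acceleration (𝓡 3) (ofRiemannian h).leviCivita (fun t y ↦ Ψ.toFun t (F₀ y)) 0 y : E3) =
      (ofRiemannian h).leviCivita V (F₀ y) (V (F₀ y)) := by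
  set cov := (ofRiemannian h).leviCivita with hcov
  set γ : ℝ → X := fun t ↦ Ψ.toFun t (F₀ y) with hγ
  have hfield : (fun s ↦ tvelocity (𝓡 3) (fun t y ↦ Ψ.toFun t (F₀ y)) s y) = fun s ↦ V (γ s) :=
    funext fun s ↦ tvelocity_isotopy_comp Ψ hΨV s y
  rw [acceleration_apply, hfield]
  have hγd : MDifferentiableAt 𝓘(ℝ, ℝ) (𝓡 3) γ 0 := (hΨV (F₀ y) 0).mdifferentiableAt
  have hVd : MDifferentiableAt (𝓡 3) (𝓡 3).tangent
      (fun x ↦ (TotalSpace.mk' E3 x (V x) : TangentBundle (𝓡 3) X)) (γ 0) :=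
    (hV _).mdifferentiableAt (by simp)
  rw [covariantDerivAlong_comp_holds cov hγd hVd]
  have hvel : velocity (𝓡 3) γ 0 = V (γ 0) := by
    have h1 := (hΨV (F₀ y) 0).mfderiv
    rw [velocity]
    change mfderiv 𝓘(ℝ, ℝ) (𝓡 3) γ 0 1 = _
    rw [h1]
    exact one_smul ℝ (V (γ 0))
  rw [hvel]
  have h0 : γ 0 = F₀ y := by simp [hγ, Ψ.map_zero]
  have key : ∀ x, x = F₀ y → (cov V x (V x) : E3) = cov V (F₀ y) (V (F₀ y)) := by
    rintro x rfl; rfl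
  exact key _ h0

end Isotopy

/-! ### Stability of area-minimising embedded minimal surfaces -/

omit [(ofRiemannian h).HasLeviCivita] [IsManifold (𝓡 2) ∞ S] in
/-- The lift of `f • W` along a map is smooth if `f` and the lift of `W` are. [folklore] -/
theorem contMDiff_lift_smul {F₀ : S → X} {W : Π y : S, TangentSpace (𝓡 3) (F₀ y)} {f : S → ℝ}
    (hf : ContMDiff (𝓡 2) 𝓘(ℝ, ℝ) ∞ f)
    (hW : ContMDiff (𝓡 2) (𝓡 3).tangent ∞
      (fun y ↦ (TotalSpace.mk' E3 (F₀ y) (W y) : TangentBundle (𝓡 3) X))) :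
    ContMDiff (𝓡 2) (𝓡 3).tangent ∞
      (fun y ↦ (TotalSpace.mk' E3 (F₀ y) (f y • W y) : TangentBundle (𝓡 3) X)) := by
  intro y₀
  set e := trivializationAt E3 (TangentSpace (𝓡 3) : X → Type _) (F₀ y₀) with he
  have hsrc : ∀ v : TangentSpace (𝓡 3) (F₀ y₀),
      (TotalSpace.mk' E3 (F₀ y₀) v : TangentBundle (𝓡 3) X) ∈ e.source := fun v ↦ by
    rw [e.mem_source]; exact FiberBundle.mem_baseSet_trivializationAt' (F₀ y₀)
  obtain ⟨hb, hWc⟩ := (e.contMDiffAt_iff (f := fun y ↦ (TotalSpace.mk' E3 (F₀ y) (W y) :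
    TangentBundle (𝓡 3) X)) (hsrc _)).1 (hW y₀)
  refine (e.contMDiffAt_iff (f := fun y ↦ (TotalSpace.mk' E3 (F₀ y) (f y • W y) :
    TangentBundle (𝓡 3) X)) (hsrc _)).2 ⟨hb, ?_⟩
  have hnear : ∀ᶠ y in 𝓝 y₀, F₀ y ∈ e.baseSet :=
    hb.continuousAt.preimage_mem_nhds (e.open_baseSet.mem_nhds
      (FiberBundle.mem_baseSet_trivializationAt' (F₀ y₀)))
  refine ((hf y₀).smul hWc).congr_of_eventuallyEq ?_
  filter_upwards [hnear] with y hy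
  show (e (TotalSpace.mk' E3 (F₀ y) (f y • W y))).2 = f y • (e (TotalSpace.mk' E3 (F₀ y) (W y))).2
  exact (e.linear ℝ hy).map_smul (f y) (W y)

variable [T2Space X] [SigmaCompactSpace X] [LocallyCompactSpace X]
  [T3Space S] [SecondCountableTopology S] [MeasurableSpace S] [BorelSpace S]
  {hpb : contMDiff_pullbackBilin (𝓡 3) X (𝓡 2) S ∞}

/-- **Area-minimising embedded minimal surfaces are stable — Schoen–Yau 1979, (2.13).** Let
`F₀ : S → X` be a smooth embedding of a surface into a Riemannian `3`-manifold `(X, h)` (Hausdorff,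
σ-compact, locally compact) which is a minimal immersion (`H ≡ 0`) with a smooth unit normal
field `ν`; let `f ∈ C_c^∞(S)` and let `K ⊆ S` be a compact set containing `supp f` in its interior
on which `F₀` is area-minimising (`IsAreaMinimizingOn`). Then
`∫_K (Ric(ν,ν) + ‖A‖²) f² dμ ≤ ∫_K ‖∇f‖² dμ` for the induced measure `dμ` of `F₀^*h`
(Schoen–Yau, Comm. Math. Phys. 65 (1979), p. 53: "By stability we have for each smooth function
`f` with compact support on `S` (2.13)"). Proof: extend `f ν` to a compactly supported ambient
field `Z` (`exists_ambient_extension`); the flows `Ψ` of `Z` and `Φ` of `∇_Z Z` (Hirsch 1976,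
Thm. 8.1.2, `uflowIsotopy`) give smooth families `Ψ_t ∘ F₀`, `Φ_s ∘ F₀` of immersions through `F₀`,
static off `supp f`, with variation fields `f ν` and the acceleration field `∇_Z Z ∘ F₀` of the
first; both areas of `K` are minimal at time `0` by hypothesis, and `stability_of_isLocalMin`
applies. [cite: SchoenYauPMT1979, §2 (2.13), p. 53] -/
theorem stability_of_isAreaMinimizingOn {F₀ : S → X}
    (hemb : IsSmoothEmbedding (𝓡 2) (𝓡 3) ∞ F₀)
    (hfi : (ofRiemannian h).IsSpacelikeImmersion (𝓡 2) F₀)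
    {ν : NormalField (𝓡 3) F₀}
    (hν : ContMDiff (𝓡 2) (𝓡 3).tangent ∞
      (fun y ↦ (TotalSpace.mk' E3 (F₀ y) (ν y) : TangentBundle (𝓡 3) X)))
    (hun : (ofRiemannian h).IsUnitNormal (𝓡 2) F₀ ν 1)
    (hmin : (ofRiemannian h).IsMaximalSlice F₀ hpb hfi ν)
    {f : S → ℝ} (hf : ContMDiff (𝓡 2) 𝓘(ℝ, ℝ) ∞ f) {K : Set S} (hK : IsCompact K)
    (hfK : tsupport f ⊆ interior K) (harea : IsAreaMinimizingOn (h := h) hpb F₀ K) :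
    Integrable (fun p ↦ ((ofRiemannian h).ricci (F₀ p) (ν p) (ν p) +
          ((ofRiemannian h).inducedMetric F₀ hpb hfi).normSq p
            ((ofRiemannian h).secondFundamentalForm (𝓡 2) F₀ ν p)) * f p ^ 2)
        ((riemannianMeasure ((ofRiemannian h).inducedRiemannianMetric F₀ hpb hfi)).restrict K) ∧
      ∫ p in K, ((ofRiemannian h).ricci (F₀ p) (ν p) (ν p) +
          ((ofRiemannian h).inducedMetric F₀ hpb hfi).normSq p
            ((ofRiemannian h).secondFundamentalForm (𝓡 2) F₀ ν p)) * f p ^ 2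
        ∂riemannianMeasure ((ofRiemannian h).inducedRiemannianMetric F₀ hpb hfi) ≤
      ∫ p in K, ((ofRiemannian h).inducedMetric F₀ hpb hfi).gradSq f p
        ∂riemannianMeasure ((ofRiemannian h).inducedRiemannianMetric F₀ hpb hfi) := by
  unfold IsAreaMinimizingOn at harea
  set cov := (ofRiemannian h).leviCivita with hcov
  -- the compact support of `f ν` and its ambient extension `Z`
  have hKf : IsCompact (tsupport f) := hK.of_isClosed_subset (isClosed_tsupport f)
    (hfK.trans interior_subset)
  have hW := contMDiff_lift_smul hf hν
  have hWK : ∀ y, y ∉ tsupport f → f y • ν y = 0 := fun y hy ↦ by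
    rw [image_eq_zero_of_notMem_tsupport hy, zero_smul]
  obtain ⟨Z, hZ, ⟨C, hC, hZC⟩, hZF⟩ := exists_ambient_extension hemb hW hKf hWK
  -- the flow of `Z`
  obtain ⟨ε, hε, hu⟩ := hasUniformLocalFlow_of_isCompact_support hZ hC hC.isClosed hZC
  set Ψ := uflowIsotopy hZ hε hu with hΨ
  have hΨZ : ∀ x, IsMIntegralCurve (fun t ↦ Ψ.toFun t x) Z := isMIntegralCurve_uflowIsotopy hZ hε hu
  -- the field `∇_Z Z` and its flow
  set Wv : Π x : X, TangentSpace (𝓡 3) x := fun x ↦ cov Z x (Z x) with hWv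
  have hWv : ContMDiff (𝓡 3) (𝓡 3).tangent ∞
      (fun x ↦ (TotalSpace.mk' E3 x (Wv x) : TangentBundle (𝓡 3) X)) := by
    have hloc := (ofRiemannian h).isLocallyContMDiff_leviCivita_holds ⊤ le_rfl
    have hcovZ := (hloc univ isOpen_univ).contMDiff (σ := Z) (hZ.of_le (by simp)).contMDiffOn
    intro x
    have h1 : ContMDiffAt (𝓡 3) ((𝓡 3).prod 𝓘(ℝ, E3 →L[ℝ] E3)) ∞
        (fun x ↦ TotalSpace.mk' (E3 →L[ℝ] E3)
          (E := fun x : X ↦ TangentSpace (𝓡 3) x →L[ℝ] TangentSpace (𝓡 3) x) x (cov Z x)) x :=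
      hcovZ.contMDiffAt (isOpen_univ.mem_nhds (mem_univ x))
    exact ContMDiffAt.clm_bundle_apply (F₁ := E3) (F₂ := E3) h1 (hZ x)
  have hWvC : ∀ x, x ∉ C → Wv x = 0 := fun x hx ↦ by
    show cov Z x (Z x) = 0
    rw [hZC x hx, map_zero]
  obtain ⟨ε', hε', hu'⟩ := hasUniformLocalFlow_of_isCompact_support hWv hC hC.isClosed hWvC
  set Φ := uflowIsotopy hWv hε' hu' with hΦ
  have hΦW : ∀ x, IsMIntegralCurve (fun t ↦ Φ.toFun t x) Wv := isMIntegralCurve_uflowIsotopy hWv hε' hu'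
  -- the two families
  set F : ℝ → S → X := fun t y ↦ Ψ.toFun t (F₀ y) with hFdef
  set G : ℝ → S → X := fun t y ↦ Φ.toFun t (F₀ y) with hGdef
  have hFs : ContMDiff (𝓘(ℝ, ℝ).prod (𝓡 2)) (𝓡 3) ∞ (fun q : ℝ × S ↦ F q.1 q.2) :=
    contMDiff_isotopy_comp Ψ hfi.contMDiff_self
  have hGs : ContMDiff (𝓘(ℝ, ℝ).prod (𝓡 2)) (𝓡 3) ∞ (fun q : ℝ × S ↦ G q.1 q.2) :=
    contMDiff_isotopy_comp Φ hfi.contMDiff_self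
  have himm : ∀ t, (ofRiemannian h).IsSpacelikeImmersion (𝓡 2) (F t) :=
    fun t ↦ isSpacelikeImmersion_isotopy_comp Ψ hfi t
  have himmG : ∀ t, (ofRiemannian h).IsSpacelikeImmersion (𝓡 2) (G t) :=
    fun t ↦ isSpacelikeImmersion_isotopy_comp Φ hfi t
  have hF0 : F 0 = F₀ := isotopy_comp_zero Ψ
  have hG0 : G 0 = F₀ := isotopy_comp_zero Φ
  have hvel : ∀ y, (tvelocity (𝓡 3) F 0 y : E3) = f y • (ν y : E3) := by
    intro y
    rw [tvelocity_isotopy_comp Ψ hΨZ 0 y]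
    have key : ∀ x, x = F₀ y → (Z x : E3) = Z (F₀ y) := by rintro x rfl; rfl
    rw [key _ (by simp [hΨ]), hZF y]
  have haccel : ∀ y, (tvelocity (𝓡 3) G 0 y : E3) = acceleration (𝓡 3) cov F 0 y := by
    intro y
    rw [tvelocity_isotopy_comp Φ hΦW 0 y, acceleration_isotopy_comp Ψ hZ hΨZ y]
    have key : ∀ x, x = F₀ y → (Wv x : E3) = Wv (F₀ y) := by rintro x rfl; rfl
    exact key _ (by simp [hΦ])
  -- static off `supp f`
  have hstatF : ∀ t y, y ∉ tsupport f → F t y = F₀ y := by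
    intro t y hy
    have hz : Z (F₀ y) = 0 := by rw [hZF y]; exact hWK y hy
    exact uflowIsotopy_apply_of_eq_zero hZ hε hu hz t
  have hstatG : ∀ t y, y ∉ tsupport f → G t y = F₀ y := by
    intro t y hy
    have hz : Z (F₀ y) = 0 := by rw [hZF y]; exact hWK y hy
    have hw : Wv (F₀ y) = 0 := by show cov Z (F₀ y) (Z (F₀ y)) = 0; rw [hz, map_zero]
    exact uflowIsotopy_apply_of_eq_zero hWv hε' hu' hw t
  -- local minimality of the two area functions
  have hmono : ∀ {Fam : ℝ → S → X} (hs : ContMDiff (𝓘(ℝ, ℝ).prod (𝓡 2)) (𝓡 3) ∞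
      (fun q : ℝ × S ↦ Fam q.1 q.2)) (hi : ∀ t, (ofRiemannian h).IsSpacelikeImmersion (𝓡 2) (Fam t))
      (h0 : Fam 0 = F₀) (hstat : ∀ t y, y ∉ tsupport f → Fam t y = F₀ y),
      IsLocalMin (areaOn hpb hi K) 0 := by
    intro Fam hs hi h0 hstat
    have hle : ∀ t, riemannianMeasure ((ofRiemannian h).inducedRiemannianMetric (Fam 0) hpb (hi 0)) K ≤
        riemannianMeasure ((ofRiemannian h).inducedRiemannianMetric (Fam t) hpb (hi t)) K :=
      harea Fam hs hi h0 ⟨tsupport f, hKf, hfK, hstat⟩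
    refine Filter.Eventually.of_forall fun t ↦ ?_
    exact ENNReal.toReal_mono (riemannianMeasure_lt_top_of_isCompact (hpb := hpb) (himm := hi) t hK).ne
      (hle t)
  have hminF : IsLocalMin (areaOn hpb himm K) 0 := hmono hFs himm hF0 hstatF
  have hminG : IsLocalMin (areaOn hpb himmG K) 0 := hmono hGs himmG hG0 hstatG
  exact stability_of_isLocalMin (himmG := himmG) (hfi := hfi) hFs hF0 hν hun hmin
    (hf.of_le (by simp)) hvel hGs hG0 haccel hK hminF hminG

end SurfaceVariation

end Literature.Geometry.Lorentzian

end
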